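import Literature.IUT.HodgeTheaters.StableCurveTemperedDataOfSpecialFibreLevelQuotientRF
import HarnessLib

/-!
# [IUTchI] Prop. 2.4 (ii) at the genuine 𝔛-datum — the residual-finiteness reading (RF)_j of every level quotient
# pair `Π^temp_{X_K} ⧸ admKer_j ↪ Π_{X_K} ⧸ cl(admKer_j)` is a THEOREM; the §2 closers re-keyed WITHOUT the `hRF` law

Mochizuki, *Inter-universal Teichmüller theory I*, kurims manuscript (May 2020), §2, proof of Prop. 2.4 (ii), p. 51
l. 8–13 "by applying [the evident analogue of] this observation to the quotients `Π^tp_X ↠ Π^tp_X/Ker(J ↠ Π^tp_{𝔾*_J})`"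
and assertion (i) p. 50 l. 46–49 (the profinite side `Π̂_X/Ker(Ĵ ↠ Π̂_{𝔾_J})`) [cite: Mochizuki2012, Prop 2.4(ii) pp.50-51]
(D-0012 claim key; nothing of the series is asserted here), over Mochizuki, *Semi-graphs of anabelioids*, Publ. RIMS
**42** (2006), Ex. 3.10 p. 45 l. 1–4, Prop. 3.6 pp. 38–39, §6 p. 69 ("natural injection `Π^temp_{X_K} ↪ Π_{X_K}`", the
profinite completion) [cite: MochizukiSemiAnbd2006, Ex 3.10 p.45].  Pages: [IUTchI] = kurims preprint render
paper:url-690e7b3c6199; [SemiAnbd] = kurims render SemiAnbd-kurims-url-f33ace170ff4 (lit/SOURCES.md §0/§11).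

PROOF-ONLY sequel (abc-iut-L5-t11 gen 8, row «RF-AT-LEVEL-QUOTIENT», file 2/2; no definition, no instance, no new
`Prop` fact; GAP-LEDGER row G-L5t11g7-3 «(RF)_j» CLOSED by `hRF_ofPiData`) of
`StableCurveTemperedDataOfSpecialFibreLevelQuotientRF.lean` (`exists_openNormal_rf_quotient_le`: residually finite
`Π^temp_{X_K}`-quotients above `admKer_j` are cofinal).  Here:
* `hres_levelQuotient` — pushed down along `Π^temp_{X_K} ↠ Π^tp_j := Π^temp_{X_K} ⧸ admKer_j` (third isomorphism
  theorem): the open normal subgroups of `Π^tp_j` with RESIDUALLY FINITE quotient are cofinal;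
* `hPC_levelQuotient` — every open subgroup of finite index of `Π^tp_j` is the inverse image under
  `ι_j : Π^tp_j ↪ Π̂_j := Π_{X_K} ⧸ cl(admKer_j)` of an open subgroup of `Π̂_j` (`Π_{X_K}` is the profinite completion
  of `Π^temp_{X_K}`: `X.isProfiniteCompletion_toHat`, normal-core trick; `cl(admKer_j)` lies in every open subgroup
  above `admKer_j`);
* **`hRF_ofPiData`** — (RF)_j in the EXACT binder type of `prop24ii_ofPiData_of_arithStatementI_canonical_of_RF`
  (p450972) / `prop24_cor25_ofPiData_byName` (p451534), for the quotient tower `qTowerOfSpecialFibreTower …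
  P.admKer_normal_pi` over the origin record `P`, by this lineage's gen-2 `closedBasis_of_residuallyFinite_quotients`;
* the closers RE-KEYED without `hRF`: `prop24ii_ofPiData_byName` ([IUTchI] Prop. 2.4 (ii) at the genuine datum from
  `hadm` and, per level, L3's typed Thm 5.4 (i) `hI` + (A3-arith) `hA3` + decomposition/node data — LAW 3, was 4) and
  the ONE CALL `prop24_cor25_ofPiData_byName_noRF` ((i) ∧ (ii) ∧ (iii) ∧ Cor. 2.5 with LAWS hTF · hNN_i · hab · hadm ·
  hI_j · hA3ar_j = 6, was 7).
CONDITIONAL, as labelled, on the remaining laws; the derivation of (RF)_j itself uses only the origin records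
(`TemperedCurve`, `GroupLevelData`, `SpecialFibreTower`, `PiData` (P0)) and theorems of the tree; typed ≠ inhabited;
nothing here asserts that abc is proved or refuted, and nothing here bears on [IUTchIII] Cor. 3.12.
-/

noncomputable section

namespace Literature.IUT.HodgeTheaters

open _root_.Topology
open scoped Pointwise
open Literature.AnabelianGeometry.SemiGraphs Literature.AnabelianGeometry.SemiGraphs.ProfiniteSemiGraph

/-- Residual finiteness is transported along group isomorphisms. [folklore] -/
private theorem residuallyFinite_of_mulEquiv' {G H : Type*} [Group G] [Group H] (e : G ≃* H)
    [hH : Group.ResiduallyFinite H] : Group.ResiduallyFinite G := by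
  rw [Group.residuallyFinite_iff_exists_finiteIndex] at hH ⊢
  intro g hg
  have hg' : e g ≠ 1 := by
    intro h; exact hg (by simpa using congrArg e.symm h)
  obtain ⟨K, hK, hgK⟩ := hH (e g) hg'
  refine ⟨K.comap e.toMonoidHom, ?_, by simpa using hgK⟩
  rw [Subgroup.finiteIndex_iff] at hK ⊢
  rwa [Subgroup.index_comap_of_surjective _ e.surjective]

namespace StableCurveTemperedData

namespace OfSpecialFibre

variable {p : ℕ} [Fact p.Prime] (X : TemperedCurve p)

/-! ### D. Descent to the level quotient pair `Π^tp_j ↪ Π̂_j`: `hres`, `hPC`, and (RF)_j -/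

/-- **Residually finite quotients of the tempered level quotient are cofinal** (`hres` of this lineage's
`closedBasis_of_residuallyFinite_quotients`, at `Π^tp_j := Π^temp_{X_K} ⧸ admKer_j`): push
`exists_openNormal_rf_quotient_le` down along `Π^temp_{X_K} ↠ Π^tp_j` (third isomorphism theorem).
([IUTchI] Prop 2.4(ii) p.51 l.8–13) [claim: Mochizuki2012, status: disputed] -/
theorem hres_levelQuotient (d : X.GroupLevelData) (T : SpecialFibreTower X.DeltaTemp) (j : ℕ)
    (hP0 : (admKerPi X T j).Normal) :
    ∀ V ∈ 𝓝 (1 : X.PiTemp ⧸ admKerPi X T j), ∃ N : OpenNormalSubgroup (X.PiTemp ⧸ admKerPi X T j),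
      (N : Set (X.PiTemp ⧸ admKerPi X T j)) ⊆ V ∧
        Group.ResiduallyFinite ((X.PiTemp ⧸ admKerPi X T j) ⧸ N.toSubgroup) := by
  intro V hV
  have hV' : ((QuotientGroup.mk' (admKerPi X T j)) ⁻¹' V) ∈ 𝓝 (1 : X.PiTemp) := by
    apply (QuotientGroup.continuous_mk (N := admKerPi X T j)).continuousAt.preimage_mem_nhds
    simpa using hV
  obtain ⟨N₀, -, hN₀V⟩ := d.isTempered.basis _ hV'
  let V₀ : Subgroup X.PiTemp := N₀.toSubgroup ⊔ admKerPi X T j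
  have hV₀o : IsOpen (V₀ : Set X.PiTemp) := Subgroup.isOpen_mono le_sup_left N₀.isOpen'
  have hV₀V : ∀ x ∈ V₀, (x : X.PiTemp ⧸ admKerPi X T j) ∈ V := by
    intro x hx
    have hx' : x ∈ ((V₀ : Subgroup X.PiTemp) : Set X.PiTemp) := hx
    rw [Subgroup.mul_normal] at hx'
    obtain ⟨n, hn, a, ha, rfl⟩ := Set.mem_mul.mp hx'
    have hna : ((n * a : X.PiTemp) : X.PiTemp ⧸ admKerPi X T j) = (n : X.PiTemp ⧸ admKerPi X T j) := by
      rw [QuotientGroup.eq]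
      simpa using (admKerPi X T j).inv_mem ha
    rw [hna]
    exact hN₀V hn
  obtain ⟨N, hAN, hNV₀, hrf⟩ :=
    exists_openNormal_rf_quotient_le X d T j hP0 V₀ hV₀o le_sup_right
  haveI := hrf
  let Nq : Subgroup (X.PiTemp ⧸ admKerPi X T j) := N.toSubgroup.map (QuotientGroup.mk' (admKerPi X T j))
  have hNqo : IsOpen (Nq : Set (X.PiTemp ⧸ admKerPi X T j)) := by
    rw [Subgroup.coe_map]
    exact QuotientGroup.isOpenMap_coe _ N.isOpen'
  have hNqn : Nq.Normal := Subgroup.Normal.map inferInstance _ (QuotientGroup.mk'_surjective _)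
  refine ⟨{ toSubgroup := Nq, isOpen' := hNqo, isNormal' := hNqn }, ?_, ?_⟩
  · rintro _ ⟨n, hn, rfl⟩
    exact hV₀V n (hNV₀ hn)
  · exact residuallyFinite_of_mulEquiv'
      (QuotientGroup.quotientQuotientEquivQuotient (admKerPi X T j) N.toSubgroup hAN)

/-- **(PC) at the level quotient pair**: every open subgroup of finite index of `Π^tp_j = Π^temp_{X_K} ⧸ admKer_j` is
the inverse image, under `ι_j : Π^tp_j ↪ Π̂_j = Π_{X_K} ⧸ cl(admKer_j)`, of an open subgroup of `Π̂_j` — from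
`Π_{X_K}` being the profinite completion of `Π^temp_{X_K}` (`X.isProfiniteCompletion_toHat`, normal-core trick) and
`ι⁻¹(cl admKer_j) = admKer_j` (abc-iut-L5-t11 `comap_admKerHat`, implicit in the closedness step).
([IUTchI] Prop 2.4(ii) p.51 l.1–3) [claim: Mochizuki2012, status: disputed] -/
theorem hPC_levelQuotient (T : SpecialFibreTower X.DeltaTemp) (j : ℕ) (hP0 : (admKerPi X T j).Normal) :
    haveI : (admKerHat X T j).Normal := admKerHat_normal X T j hP0
    ∀ U : Subgroup (X.PiTemp ⧸ admKerPi X T j), IsOpen (U : Set (X.PiTemp ⧸ admKerPi X T j)) → U.FiniteIndex →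
      ∃ W : Subgroup (X.PiHat ⧸ admKerHat X T j), IsOpen (W : Set (X.PiHat ⧸ admKerHat X T j)) ∧
        W.comap (QuotientGroup.map (admKerPi X T j) (admKerHat X T j) X.toHat.toMonoidHom
          (admKerPi_le_comap_admKerHat X T j)) = U := by
  haveI : (admKerHat X T j).Normal := admKerHat_normal X T j hP0
  intro U hUo hUfi
  let U' : Subgroup X.PiTemp := U.comap (QuotientGroup.mk' (admKerPi X T j))
  have hU'o : IsOpen (U' : Set X.PiTemp) := hUo.preimage (QuotientGroup.continuous_mk (N := admKerPi X T j))
  haveI hU'fi : U'.FiniteIndex := by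
    rw [Subgroup.finiteIndex_iff, Subgroup.index_comap_of_surjective _ (QuotientGroup.mk'_surjective _)]
    exact hUfi.index_ne_zero
  have hAU' : admKerPi X T j ≤ U' := by
    intro a ha
    rw [Subgroup.mem_comap, QuotientGroup.mk'_apply, (QuotientGroup.eq_one_iff a).mpr ha]
    exact U.one_mem
  -- top level: `U' = toHat⁻¹(W')` for an open `W' ≤ Π_{X_K}` (normal-core trick on the profinite completion)
  haveI : U'.normalCore.FiniteIndex := Subgroup.finiteIndex_normalCore U'
  have hCo : IsOpen (U'.normalCore : Set X.PiTemp) :=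
    Subgroup.isOpen_of_isClosed_of_finiteIndex _
      (Subgroup.normalCore_isClosed U' (Subgroup.isClosed_of_isOpen U' hU'o))
  let C : OpenNormalSubgroup X.PiTemp :=
    { toSubgroup := U'.normalCore, isOpen' := hCo, isNormal' := Subgroup.normalCore_normal U' }
  obtain ⟨V', hV'⟩ := X.isProfiniteCompletion_toHat.comap_surjective C inferInstance
  have hVC : V'.toSubgroup.comap X.toHat.toMonoidHom = U'.normalCore := hV'.symm
  let W' : Subgroup X.PiHat := U'.map X.toHat.toMonoidHom ⊔ V'.toSubgroup
  have hW'o : IsOpen (W' : Set X.PiHat) := Subgroup.isOpen_mono le_sup_right V'.isOpen'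
  have hW'U : W'.comap X.toHat.toMonoidHom = U' := by
    apply le_antisymm
    · intro x hx
      rw [Subgroup.mem_comap] at hx
      have hx' : X.toHat.toMonoidHom x ∈ ((W' : Subgroup X.PiHat) : Set X.PiHat) := hx
      rw [Subgroup.mul_normal] at hx'
      obtain ⟨y, hy, v, hv, hyv⟩ := Set.mem_mul.mp hx'
      obtain ⟨u, hu, rfl⟩ := Subgroup.mem_map.mp hy
      have huv : X.toHat.toMonoidHom (u⁻¹ * x) ∈ V'.toSubgroup := by
        rw [map_mul, map_inv, ← hyv, inv_mul_cancel_left]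
        exact hv
      have hux : u⁻¹ * x ∈ U' := U'.normalCore_le (hVC ▸ Subgroup.mem_comap.mpr huv)
      simpa using U'.mul_mem hu hux
    · exact le_trans (Subgroup.le_comap_map _ U') (Subgroup.comap_mono le_sup_left)
  have hAW' : admKerHat X T j ≤ W' := by
    apply Subgroup.topologicalClosure_minimal
    · exact (Subgroup.map_mono hAU').trans le_sup_left
    · exact Subgroup.isClosed_of_isOpen W' hW'o
  refine ⟨W'.map (QuotientGroup.mk' (admKerHat X T j)), ?_, ?_⟩
  · rw [Subgroup.coe_map]
    exact QuotientGroup.isOpenMap_coe _ hW'o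
  · ext q
    induction q using QuotientGroup.induction_on with
    | H t =>
      rw [Subgroup.mem_comap, QuotientGroup.map_mk]
      constructor
      · rintro ⟨w, hw, hwt⟩
        rw [QuotientGroup.mk'_apply, QuotientGroup.eq] at hwt
        have hwt' : X.toHat.toMonoidHom t ∈ W' := by
          simpa using W'.mul_mem hw (hAW' hwt)
        have ht : t ∈ U' := by rw [← hW'U]; exact hwt'
        exact ht
      · intro ht
        have ht' : t ∈ U' := ht
        rw [← hW'U] at ht'
        exact ⟨X.toHat.toMonoidHom t, ht', rfl⟩

variable (d : X.GroupLevelData) (T : SpecialFibreTower X.DeltaTemp)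
  (Sigma SigmaHat : Set ℕ) (hsub : Sigma ⊆ SigmaHat) (hne : Set.Nonempty Sigma)
  (hprime : ∀ q ∈ SigmaHat, q.Prime)
  (S : SpecialFibreData (X.toTemperedArithmeticGroup d)) (h36 : S.Gc.Prop36Hypotheses)
  (hp : p ∉ Sigma) (TpH : Subgroup S.chart.G)
  (HatH : Subgroup (TemperedGraphGroupData.exists_completion_of_prop36 S.Gc h36 S.chart).choose)
  (hle : TpH.map (TemperedGraphGroupData.exists_completion_of_prop36 S.Gc h36
    S.chart).choose_spec.choose.toMonoidHom ≤ HatH)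
  (cuspMeetsH : {x : X.Pt // X.IsCusp x} → Prop)

/-- **(RF)_j IS A THEOREM at the genuine 𝔛-datum over `P`** — the residual-finiteness reading of [IUTchI] p. 51
l. 8–13 / [SemiAnbd] Ex. 3.10 p. 45 l. 1–4 at EVERY level quotient `Π^tp_X/Ker(J ↠ Π^tp_{𝔾*_J}) ↪ Π̂_X/Ker(Ĵ ↠ Π̂_{𝔾_J})`
of the quotient tower `qTowerOfSpecialFibreTower … P.admKer_normal_pi`: "the open normal subgroups of `Π^tp_j` that
are closed for the `Π̂_j`-topology are cofinal among the neighbourhoods of `1`" — literally the binder `hRF` of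
`prop24ii_ofPiData_of_arithStatementI_canonical_of_RF` (p450972) and of the one-call `prop24_cor25_ofPiData_byName`
(p451534), now DERIVED: `closedBasis_of_residuallyFinite_quotients` (abc-iut-L5-t11 gen 2) with `hPC_levelQuotient`
and `hres_levelQuotient`. ([IUTchI] Prop 2.4(ii) p.51) [claim: Mochizuki2012, status: disputed] -/
theorem hRF_ofPiData (P : SpecialFibreTower.PiData X d S T) (j : ℕ) :
    ∀ U ∈ 𝓝 (1 : ((qTowerOfSpecialFibreTower X T d S h36 Sigma SigmaHat hsub hne hprime hp TpH HatH hle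
        cuspMeetsH P.admKer_normal_pi).Q j).Tp),
      ∃ N : OpenNormalSubgroup ((qTowerOfSpecialFibreTower X T d S h36 Sigma SigmaHat hsub hne hprime hp TpH HatH hle
          cuspMeetsH P.admKer_normal_pi).Q j).Tp,
        (N : Set _) ⊆ U ∧
          ((N.toSubgroup.map ((qTowerOfSpecialFibreTower X T d S h36 Sigma SigmaHat hsub hne hprime hp TpH HatH hle
              cuspMeetsH P.admKer_normal_pi).Q j).ι).topologicalClosure).comap
            ((qTowerOfSpecialFibreTower X T d S h36 Sigma SigmaHat hsub hne hprime hp TpH HatH hle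
              cuspMeetsH P.admKer_normal_pi).Q j).ι ≤ N.toSubgroup :=
  closedBasis_of_residuallyFinite_quotients _ (hPC_levelQuotient X T j (P.admKer_normal_pi j))
    (hres_levelQuotient X d T j (P.admKer_normal_pi j))


/-! ### E. The §2 closers re-keyed WITHOUT the `hRF` law -/

/-- **[IUTchI] Prop. 2.4 (ii) AS TYPED at the genuine 𝔛-datum over `P`, (RF)_j DISCHARGED** —
`prop24ii_ofPiData_of_arithStatementI_canonical_of_RF` (p450972) with `hRF := hRF_ofPiData …`.  Laws: `hadm`; per
level L3's TYPED [SemiAnbd] Thm 5.4 (i) for the canonical augmentation (`hI`) and (A3-arith) (`hA3`); data: per-level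
`DecompositionData` and nodes with tempered branch conjugators.
([IUTchI] Prop 2.4(ii) pp.50-51) [claim: Mochizuki2012, status: disputed] -/
theorem prop24ii_ofPiData_byName (P : SpecialFibreTower.PiData X d S T)
    (hadm : ∀ U ∈ 𝓝 (1 : ↥X.DeltaTemp), ∃ j, ((T.admKer j : Subgroup ↥X.DeltaTemp) : Set ↥X.DeltaTemp) ⊆ U)
    {V B : ℕ → Type*}
    (Dd : ∀ j, DecompositionData ((qTowerOfSpecialFibreTower X T d S h36 Sigma SigmaHat hsub hne hprime hp TpH HatH hle cuspMeetsH P.admKer_normal_pi).Q j).Tp (V j) (B j))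
    (hI : ∀ (j : ℕ) (a : ((qTowerOfSpecialFibreTower X T d S h36 Sigma SigmaHat hsub hne hprime hp TpH HatH hle cuspMeetsH P.admKer_normal_pi).Q j).Tp →* X.GK),
      a.comp ((qTowerOfSpecialFibreTower X T d S h36 Sigma SigmaHat hsub hne hprime hp TpH HatH hle cuspMeetsH P.admKer_normal_pi).qtp j) = X.augGK.toMonoidHom →
        ArithMaximalCompactStatementI (Dd j) a)
    {E : ℕ → Type*} (src tgt : ∀ j, E j → V j)
    (c₁ c₂ : ∀ j, E j → ((qTowerOfSpecialFibreTower X T d S h36 Sigma SigmaHat hsub hne hprime hp TpH HatH hle cuspMeetsH P.admKer_normal_pi).Q j).Tp)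
    (hA3 : ∀ (j : ℕ) (Λ : Subgroup X.PiTemp), IsCompact (Λ : Set X.PiTemp) → Λ ≠ ⊥ →
      IsOpen (Λ.map X.augGK.toMonoidHom : Set X.GK) →
      ∀ (v w : V j) (g h γ : ((qTowerOfSpecialFibreTower X T d S h36 Sigma SigmaHat hsub hne hprime hp TpH HatH hle cuspMeetsH P.admKer_normal_pi).Q j).Hat),
        MulAut.conj γ • Λ.map (((qTowerOfSpecialFibreTower X T d S h36 Sigma SigmaHat hsub hne hprime hp TpH HatH hle cuspMeetsH P.admKer_normal_pi).qhat j).comp X.toHat.toMonoidHom) ≤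
            MulAut.conj g • ((Dd j).vertGp v).map ((qTowerOfSpecialFibreTower X T d S h36 Sigma SigmaHat hsub hne hprime hp TpH HatH hle cuspMeetsH P.admKer_normal_pi).Q j).ι →
        MulAut.conj γ • Λ.map (((qTowerOfSpecialFibreTower X T d S h36 Sigma SigmaHat hsub hne hprime hp TpH HatH hle cuspMeetsH P.admKer_normal_pi).qhat j).comp X.toHat.toMonoidHom) ≤
            MulAut.conj h • ((Dd j).vertGp w).map ((qTowerOfSpecialFibreTower X T d S h36 Sigma SigmaHat hsub hne hprime hp TpH HatH hle cuspMeetsH P.admKer_normal_pi).Q j).ι →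
          (v = w ∧ g⁻¹ * h ∈ ((Dd j).vertGp v).map ((qTowerOfSpecialFibreTower X T d S h36 Sigma SigmaHat hsub hne hprime hp TpH HatH hle cuspMeetsH P.admKer_normal_pi).Q j).ι) ∨
          (∃ (e : E j) (k : ((qTowerOfSpecialFibreTower X T d S h36 Sigma SigmaHat hsub hne hprime hp TpH HatH hle cuspMeetsH P.admKer_normal_pi).Q j).Hat),
            ∃ p ∈ ((Dd j).vertGp (src j e)).map ((qTowerOfSpecialFibreTower X T d S h36 Sigma SigmaHat hsub hne hprime hp TpH HatH hle cuspMeetsH P.admKer_normal_pi).Q j).ι,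
            ∃ q ∈ ((Dd j).vertGp (tgt j e)).map ((qTowerOfSpecialFibreTower X T d S h36 Sigma SigmaHat hsub hne hprime hp TpH HatH hle cuspMeetsH P.admKer_normal_pi).Q j).ι,
            (src j e = v ∧ tgt j e = w ∧
                g = k * ((qTowerOfSpecialFibreTower X T d S h36 Sigma SigmaHat hsub hne hprime hp TpH HatH hle cuspMeetsH P.admKer_normal_pi).Q j).ι (c₁ j e) * p ∧
                h = k * ((qTowerOfSpecialFibreTower X T d S h36 Sigma SigmaHat hsub hne hprime hp TpH HatH hle cuspMeetsH P.admKer_normal_pi).Q j).ι (c₂ j e) * q) ∨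
            (src j e = w ∧ tgt j e = v ∧
                h = k * ((qTowerOfSpecialFibreTower X T d S h36 Sigma SigmaHat hsub hne hprime hp TpH HatH hle cuspMeetsH P.admKer_normal_pi).Q j).ι (c₁ j e) * p ∧
                g = k * ((qTowerOfSpecialFibreTower X T d S h36 Sigma SigmaHat hsub hne hprime hp TpH HatH hle cuspMeetsH P.admKer_normal_pi).Q j).ι (c₂ j e) * q)) ∨
          (∃ (u : V j) (f : ((qTowerOfSpecialFibreTower X T d S h36 Sigma SigmaHat hsub hne hprime hp TpH HatH hle cuspMeetsH P.admKer_normal_pi).Q j).Hat),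
            (∃ (e : E j) (k : ((qTowerOfSpecialFibreTower X T d S h36 Sigma SigmaHat hsub hne hprime hp TpH HatH hle cuspMeetsH P.admKer_normal_pi).Q j).Hat),
              ∃ p ∈ ((Dd j).vertGp (src j e)).map ((qTowerOfSpecialFibreTower X T d S h36 Sigma SigmaHat hsub hne hprime hp TpH HatH hle cuspMeetsH P.admKer_normal_pi).Q j).ι,
              ∃ q ∈ ((Dd j).vertGp (tgt j e)).map ((qTowerOfSpecialFibreTower X T d S h36 Sigma SigmaHat hsub hne hprime hp TpH HatH hle cuspMeetsH P.admKer_normal_pi).Q j).ι,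
              (src j e = v ∧ tgt j e = u ∧
                  g = k * ((qTowerOfSpecialFibreTower X T d S h36 Sigma SigmaHat hsub hne hprime hp TpH HatH hle cuspMeetsH P.admKer_normal_pi).Q j).ι (c₁ j e) * p ∧
                  f = k * ((qTowerOfSpecialFibreTower X T d S h36 Sigma SigmaHat hsub hne hprime hp TpH HatH hle cuspMeetsH P.admKer_normal_pi).Q j).ι (c₂ j e) * q) ∨
              (src j e = u ∧ tgt j e = v ∧
                  f = k * ((qTowerOfSpecialFibreTower X T d S h36 Sigma SigmaHat hsub hne hprime hp TpH HatH hle cuspMeetsH P.admKer_normal_pi).Q j).ι (c₁ j e) * p ∧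
                  g = k * ((qTowerOfSpecialFibreTower X T d S h36 Sigma SigmaHat hsub hne hprime hp TpH HatH hle cuspMeetsH P.admKer_normal_pi).Q j).ι (c₂ j e) * q)) ∧
            (∃ (e : E j) (k : ((qTowerOfSpecialFibreTower X T d S h36 Sigma SigmaHat hsub hne hprime hp TpH HatH hle cuspMeetsH P.admKer_normal_pi).Q j).Hat),
              ∃ p ∈ ((Dd j).vertGp (src j e)).map ((qTowerOfSpecialFibreTower X T d S h36 Sigma SigmaHat hsub hne hprime hp TpH HatH hle cuspMeetsH P.admKer_normal_pi).Q j).ι,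
              ∃ q ∈ ((Dd j).vertGp (tgt j e)).map ((qTowerOfSpecialFibreTower X T d S h36 Sigma SigmaHat hsub hne hprime hp TpH HatH hle cuspMeetsH P.admKer_normal_pi).Q j).ι,
              (src j e = u ∧ tgt j e = w ∧
                  f = k * ((qTowerOfSpecialFibreTower X T d S h36 Sigma SigmaHat hsub hne hprime hp TpH HatH hle cuspMeetsH P.admKer_normal_pi).Q j).ι (c₁ j e) * p ∧
                  h = k * ((qTowerOfSpecialFibreTower X T d S h36 Sigma SigmaHat hsub hne hprime hp TpH HatH hle cuspMeetsH P.admKer_normal_pi).Q j).ι (c₂ j e) * q) ∨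
              (src j e = w ∧ tgt j e = u ∧
                  h = k * ((qTowerOfSpecialFibreTower X T d S h36 Sigma SigmaHat hsub hne hprime hp TpH HatH hle cuspMeetsH P.admKer_normal_pi).Q j).ι (c₁ j e) * p ∧
                  f = k * ((qTowerOfSpecialFibreTower X T d S h36 Sigma SigmaHat hsub hne hprime hp TpH HatH hle cuspMeetsH P.admKer_normal_pi).Q j).ι (c₂ j e) * q)))) :
    (ofSpecialFibre X d S h36 Sigma SigmaHat hsub hne hprime hp TpH HatH hle cuspMeetsH).Prop24ii :=
  prop24ii_ofPiData_of_arithStatementI_canonical_of_RF X T d S h36 Sigma SigmaHat hsub hne hprime hp TpH HatH hle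
    cuspMeetsH P hadm Dd hI
    (hRF_ofPiData X d T Sigma SigmaHat hsub hne hprime S h36 hp TpH HatH hle cuspMeetsH P)
    src tgt c₁ c₂ hA3

/-- **[IUTchI] Prop. 2.4 (i)(ii)(iii) ∧ Cor. 2.5 AS TYPED at the genuine 𝔛-datum over `P`, ONE CALL, (RF)_j
DISCHARGED** — the one-call `prop24_cor25_ofPiData_byName` (p451534) with `hRF := hRF_ofPiData …`.  LAW list:
hTF ([Config] Rmk 1.2.2 printed form) · hNN_i (F-2540) · hab · hadm · hI_j (L3's typed Thm 5.4 (i)) · hA3ar_j = 6;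
data/side conditions as there. ([IUTchI] Prop 2.4, Cor 2.5 pp.50-51) [claim: Mochizuki2012, status: disputed] -/
theorem prop24_cor25_ofPiData_byName_noRF (P : SpecialFibreTower.PiData X d S T) (x : {x : X.Pt // X.IsCusp x})
    -- (i): [Config] Rmk 1.2.2, printed form on `X.DeltaHat`
    (hTF : ∀ H : Subgroup X.DeltaHat, IsOpen (H : Set X.DeltaHat) →
      ∀ (h : H) (n : ℕ), n ≠ 0 →
        SigmaCharDetects Set.univ H h → SigmaCharDetects Set.univ H (h ^ n))
    -- (i): per-level PSC data with (A3) := F-2540 BY NAME and the identification side conditions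
    (G : ∀ i, PSCDatum (levelGraph X T Sigma SigmaHat hsub hne hprime i).Hat)
    (hNN : ∀ i, (G i).VerticialIntersectionNear)
    (σ : ∀ i, (T.Gc i).graph.Vertex ≃ (G i).graph.V) (Λv : ∀ i, (G i).graph.V → Subgroup (T.chart i).G)
    (hvert : ∀ i (v : (T.Gc i).graph.Vertex), Λv i (σ i v) ∈ verticialSubgroups (T.chart i) v)
    (hΛv : ∀ i v, (Λv i v).map (levelGraph X T Sigma SigmaHat hsub hne hprime i).ι = (G i).vertGp v)
    (src tgt : ∀ i, (G i).graph.N → (G i).graph.V) (c₁ c₂ : ∀ i, (G i).graph.N → (T.chart i).G)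
    (hends : ∀ i e, (G i).graph.nodeEnds e = s(src i e, tgt i e))
    (h₁ : ∀ i e, (G i).nodeGp e ≤
      MulAut.conj ((levelGraph X T Sigma SigmaHat hsub hne hprime i).ι (c₁ i e)) • (G i).vertGp (src i e))
    (h₂ : ∀ i e, (G i).nodeGp e ≤
      MulAut.conj ((levelGraph X T Sigma SigmaHat hsub hne hprime i).ι (c₂ i e)) • (G i).vertGp (tgt i e))
    (hloop : ∀ i e, src i e = tgt i e → (c₁ i e)⁻¹ * c₂ i e ∉ Λv i (src i e))
    -- (i): the pro-`Σ` abelianization law along the admissible quotients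
    (hab : ∀ (i : ℕ) (A : Type) [CommGroup A] [Finite A] (χ : T.N i →* A),
      IsOpen ((χ.ker : Subgroup (T.N i)) : Set (T.N i)) →
      (∀ q : ℕ, q.Prime → q ∣ Nat.card A → q ∈ Sigma) → (T.adm i).toMonoidHom.ker ≤ χ.ker)
    -- (i)(ii): the admissible kernels shrink to `1`
    (hadm : ∀ U ∈ 𝓝 (1 : ↥X.DeltaTemp), ∃ j, ((T.admKer j : Subgroup ↥X.DeltaTemp) : Set ↥X.DeltaTemp) ⊆ U)
    -- (ii): per-level arithmetic decomposition data, L3's typed Thm 5.4 (i), (RF)_j, node data, (A3-arith)_j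
    {V B : ℕ → Type*}
    (Dd : ∀ j, DecompositionData ((qTowerOfSpecialFibreTower X T d S h36 Sigma SigmaHat hsub hne hprime hp TpH HatH hle cuspMeetsH P.admKer_normal_pi).Q j).Tp (V j) (B j))
    (hI : ∀ (j : ℕ) (a : ((qTowerOfSpecialFibreTower X T d S h36 Sigma SigmaHat hsub hne hprime hp TpH HatH hle cuspMeetsH P.admKer_normal_pi).Q j).Tp →* X.GK),
      a.comp ((qTowerOfSpecialFibreTower X T d S h36 Sigma SigmaHat hsub hne hprime hp TpH HatH hle cuspMeetsH P.admKer_normal_pi).qtp j) = X.augGK.toMonoidHom →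
        ArithMaximalCompactStatementI (Dd j) a)
    {EA : ℕ → Type*} (srcA tgtA : ∀ j, EA j → V j)
    (c₁A c₂A : ∀ j, EA j → ((qTowerOfSpecialFibreTower X T d S h36 Sigma SigmaHat hsub hne hprime hp TpH HatH hle cuspMeetsH P.admKer_normal_pi).Q j).Tp)
    (hA3ar : ∀ (j : ℕ) (Λ : Subgroup X.PiTemp), IsCompact (Λ : Set X.PiTemp) → Λ ≠ ⊥ →
      IsOpen (Λ.map X.augGK.toMonoidHom : Set X.GK) →
      ∀ (v w : V j) (g h γ : ((qTowerOfSpecialFibreTower X T d S h36 Sigma SigmaHat hsub hne hprime hp TpH HatH hle cuspMeetsH P.admKer_normal_pi).Q j).Hat),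
        MulAut.conj γ • Λ.map (((qTowerOfSpecialFibreTower X T d S h36 Sigma SigmaHat hsub hne hprime hp TpH HatH hle cuspMeetsH P.admKer_normal_pi).qhat j).comp X.toHat.toMonoidHom) ≤
            MulAut.conj g • ((Dd j).vertGp v).map ((qTowerOfSpecialFibreTower X T d S h36 Sigma SigmaHat hsub hne hprime hp TpH HatH hle cuspMeetsH P.admKer_normal_pi).Q j).ι →
        MulAut.conj γ • Λ.map (((qTowerOfSpecialFibreTower X T d S h36 Sigma SigmaHat hsub hne hprime hp TpH HatH hle cuspMeetsH P.admKer_normal_pi).qhat j).comp X.toHat.toMonoidHom) ≤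
            MulAut.conj h • ((Dd j).vertGp w).map ((qTowerOfSpecialFibreTower X T d S h36 Sigma SigmaHat hsub hne hprime hp TpH HatH hle cuspMeetsH P.admKer_normal_pi).Q j).ι →
          (v = w ∧ g⁻¹ * h ∈ ((Dd j).vertGp v).map ((qTowerOfSpecialFibreTower X T d S h36 Sigma SigmaHat hsub hne hprime hp TpH HatH hle cuspMeetsH P.admKer_normal_pi).Q j).ι) ∨
          (∃ (e : EA j) (k : ((qTowerOfSpecialFibreTower X T d S h36 Sigma SigmaHat hsub hne hprime hp TpH HatH hle cuspMeetsH P.admKer_normal_pi).Q j).Hat),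
            ∃ p ∈ ((Dd j).vertGp (srcA j e)).map ((qTowerOfSpecialFibreTower X T d S h36 Sigma SigmaHat hsub hne hprime hp TpH HatH hle cuspMeetsH P.admKer_normal_pi).Q j).ι,
            ∃ q ∈ ((Dd j).vertGp (tgtA j e)).map ((qTowerOfSpecialFibreTower X T d S h36 Sigma SigmaHat hsub hne hprime hp TpH HatH hle cuspMeetsH P.admKer_normal_pi).Q j).ι,
            (srcA j e = v ∧ tgtA j e = w ∧
                g = k * ((qTowerOfSpecialFibreTower X T d S h36 Sigma SigmaHat hsub hne hprime hp TpH HatH hle cuspMeetsH P.admKer_normal_pi).Q j).ι (c₁A j e) * p ∧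
                h = k * ((qTowerOfSpecialFibreTower X T d S h36 Sigma SigmaHat hsub hne hprime hp TpH HatH hle cuspMeetsH P.admKer_normal_pi).Q j).ι (c₂A j e) * q) ∨
            (srcA j e = w ∧ tgtA j e = v ∧
                h = k * ((qTowerOfSpecialFibreTower X T d S h36 Sigma SigmaHat hsub hne hprime hp TpH HatH hle cuspMeetsH P.admKer_normal_pi).Q j).ι (c₁A j e) * p ∧
                g = k * ((qTowerOfSpecialFibreTower X T d S h36 Sigma SigmaHat hsub hne hprime hp TpH HatH hle cuspMeetsH P.admKer_normal_pi).Q j).ι (c₂A j e) * q)) ∨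
          (∃ (u : V j) (f : ((qTowerOfSpecialFibreTower X T d S h36 Sigma SigmaHat hsub hne hprime hp TpH HatH hle cuspMeetsH P.admKer_normal_pi).Q j).Hat),
            (∃ (e : EA j) (k : ((qTowerOfSpecialFibreTower X T d S h36 Sigma SigmaHat hsub hne hprime hp TpH HatH hle cuspMeetsH P.admKer_normal_pi).Q j).Hat),
              ∃ p ∈ ((Dd j).vertGp (srcA j e)).map ((qTowerOfSpecialFibreTower X T d S h36 Sigma SigmaHat hsub hne hprime hp TpH HatH hle cuspMeetsH P.admKer_normal_pi).Q j).ι,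
              ∃ q ∈ ((Dd j).vertGp (tgtA j e)).map ((qTowerOfSpecialFibreTower X T d S h36 Sigma SigmaHat hsub hne hprime hp TpH HatH hle cuspMeetsH P.admKer_normal_pi).Q j).ι,
              (srcA j e = v ∧ tgtA j e = u ∧
                  g = k * ((qTowerOfSpecialFibreTower X T d S h36 Sigma SigmaHat hsub hne hprime hp TpH HatH hle cuspMeetsH P.admKer_normal_pi).Q j).ι (c₁A j e) * p ∧
                  f = k * ((qTowerOfSpecialFibreTower X T d S h36 Sigma SigmaHat hsub hne hprime hp TpH HatH hle cuspMeetsH P.admKer_normal_pi).Q j).ι (c₂A j e) * q) ∨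
              (srcA j e = u ∧ tgtA j e = v ∧
                  f = k * ((qTowerOfSpecialFibreTower X T d S h36 Sigma SigmaHat hsub hne hprime hp TpH HatH hle cuspMeetsH P.admKer_normal_pi).Q j).ι (c₁A j e) * p ∧
                  g = k * ((qTowerOfSpecialFibreTower X T d S h36 Sigma SigmaHat hsub hne hprime hp TpH HatH hle cuspMeetsH P.admKer_normal_pi).Q j).ι (c₂A j e) * q)) ∧
            (∃ (e : EA j) (k : ((qTowerOfSpecialFibreTower X T d S h36 Sigma SigmaHat hsub hne hprime hp TpH HatH hle cuspMeetsH P.admKer_normal_pi).Q j).Hat),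
              ∃ p ∈ ((Dd j).vertGp (srcA j e)).map ((qTowerOfSpecialFibreTower X T d S h36 Sigma SigmaHat hsub hne hprime hp TpH HatH hle cuspMeetsH P.admKer_normal_pi).Q j).ι,
              ∃ q ∈ ((Dd j).vertGp (tgtA j e)).map ((qTowerOfSpecialFibreTower X T d S h36 Sigma SigmaHat hsub hne hprime hp TpH HatH hle cuspMeetsH P.admKer_normal_pi).Q j).ι,
              (srcA j e = u ∧ tgtA j e = w ∧
                  f = k * ((qTowerOfSpecialFibreTower X T d S h36 Sigma SigmaHat hsub hne hprime hp TpH HatH hle cuspMeetsH P.admKer_normal_pi).Q j).ι (c₁A j e) * p ∧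
                  h = k * ((qTowerOfSpecialFibreTower X T d S h36 Sigma SigmaHat hsub hne hprime hp TpH HatH hle cuspMeetsH P.admKer_normal_pi).Q j).ι (c₂A j e) * q) ∨
              (srcA j e = w ∧ tgtA j e = u ∧
                  h = k * ((qTowerOfSpecialFibreTower X T d S h36 Sigma SigmaHat hsub hne hprime hp TpH HatH hle cuspMeetsH P.admKer_normal_pi).Q j).ι (c₁A j e) * p ∧
                  f = k * ((qTowerOfSpecialFibreTower X T d S h36 Sigma SigmaHat hsub hne hprime hp TpH HatH hle cuspMeetsH P.admKer_normal_pi).Q j).ι (c₂A j e) * q)))) :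
    ((ofSpecialFibre X d S h36 Sigma SigmaHat hsub hne hprime hp TpH HatH hle cuspMeetsH).Prop24i ∧
      (ofSpecialFibre X d S h36 Sigma SigmaHat hsub hne hprime hp TpH HatH hle cuspMeetsH).Prop24ii ∧
      (ofSpecialFibre X d S h36 Sigma SigmaHat hsub hne hprime hp TpH HatH hle cuspMeetsH).Prop24iii) ∧
    ((ofSpecialFibre X d S h36 Sigma SigmaHat hsub hne hprime hp TpH HatH hle cuspMeetsH).Cor25Decomposition ∧
      (ofSpecialFibre X d S h36 Sigma SigmaHat hsub hne hprime hp TpH HatH hle cuspMeetsH).Cor25Inertia) :=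
  prop24_cor25_ofPiData_byName X d T Sigma SigmaHat hsub hne hprime S h36 hp TpH HatH hle cuspMeetsH P x hTF G hNN σ Λv
    hvert hΛv src tgt c₁ c₂ hends h₁ h₂ hloop hab hadm Dd hI
    (hRF_ofPiData X d T Sigma SigmaHat hsub hne hprime S h36 hp TpH HatH hle cuspMeetsH P)
    srcA tgtA c₁A c₂A hA3ar

end OfSpecialFibre

end StableCurveTemperedData

end Literature.IUT.HodgeTheaters

end
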